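import Summits.BirchSwinnertonDyer.BirchSwinnertonDyer.Theorems.KimAtThreeShallowEqDeepGoodOfDefinedKato
import Literature.NumberTheory.EllipticCurves.LocalTorsionAdditiveReductionPPrimaryProofs
import HarnessLib

/-!
# Route `KimAtThreeKolyvagin` (W2): seat acc3's two-exponent fine Kato package (C1₂) of the ADDITIVE-DEFECT rows with
# `3 ∤ c_P` DERIVED from a φ-level DEFINED-KATO package with the EXACT compatibility (`b = 0`) — and the same
# package on the Kato stratum (a road to 19560's (C1) without a unit-trace element)

Cell `bsd-addord`, seat `bsd-addord-w2-c4` (gen 10; OWNER of crux 19599 `ShallowEqDeepOffKatoStratum`, item 19077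
`ShallowEqDeepAtTorsionFree`).  `--supports` 19599.  HONEST FRAMING: END-TYPE TOOL THEOREMS WITH DISPLAYED HYPOTHESES
(no definition, no named fact, no instance, no `sorry`); `Λ`, `φ` abstract; nothing asserted, nothing booked; 19560 /
19599 / 19077 stay OPEN; BSD is not proved by any of this.

## What, and why
At an ADDITIVE `3` the log lattice CONTAINS `𝓞_K` (`E₀(K)/E₁(K) ≅ Ẽ_ns(k) = (k, +)`, so `log_ω(E₀(K) ⊗ ℤ₃) = 𝓞_K` at
every unramified `K`), hence `exp*_ω(H¹(K,T)) ⊆ 𝓞_K` and seat w2-c3's compatibility holds with the EXACT exponent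
`b = 0`: «`φ(h) ⊗ 1 − Λ_{0,r}(y) ∈ 3^{j+1}·L_int`» =: (C1ₑₓ⁰ᵘ) (with R-κ: `κK` a rational `3`-unit — true at
`3 ∤ c_P`).  At the base `log_ω(E(ℚ₃)) = 3^{1+t−v₃(c₃)−v₃#Ẽ_ns}ℤ₃ = 3^{−v₃(c₃)}ℤ₃` (`t = 0`, `#Ẽ_ns(𝔽₃) = 3` by
`reductionPointCount_of_additive`), so `exp*_ω(H¹(ℚ₃,T)) = 3^{v₃(c₃)}ℤ₃` (Kim's Lemma L′ AS A THEOREM from `hdual`)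
and w2-c3's `rider₂_of_compat` at `(a, b, t) = (0, 0, 0)` yields acc6's two-exponent rider at `(0, e)` with
`e = v₃(c₃)` — i.e. (C1₂) on the `3 ∣ c₃` rows (`e = 1`), and kim3's exponent-`0` rider on the Kato stratum
(`3 ∤ c₃`, `e = 0`).
* §1 `exists_normalised_of_dual_of_additive` — `φ = 3^{v₃(c₃)}·φ′`, `φ′` integral and onto `ℤ₃`.
* §2 `rider₂_of_smul_zero` (bookkeeping) and **`fineKato₂_of_definedKatoExact`** — (C1ₑₓ⁰ᵘ) at an additive `t = 0`
  row ⟹ FINEKATO₂ (acc3's (C1₂) text at the row) with `e := v₃(c₃)`.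
READING (08-28): the `3 ∣ c₃ ∧ 3 ∤ c_P` additive-defect rows of 19599 / 19077 / 19679 / 19562 rest on a φ-level
defined-Kato package too (the SAME shape as the multiplicative rows' (C1ₑₓ¹ᵘ) with `b = 0`); the Manin rows `3 ∣ c_P`
keep acc3's (C1₂) (there `hdual` and a unit `κ` are incompatible).  On the Kato stratum the package gives the
two-exponent rider at `(0, 0)` — a unit-trace-free road into 19560's (C1), offered to its LEAD (not assembled here).
References: [BlochKato1990] §3; [Kato2004Asterisque] §9.4, Thm. 9.7; [Kim2022StructureSelmer] §3.2.3, Thm. 3.6, Rem. 3.7,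
Lemma 3.9, Thm. 3.13; [SilvermanAEC2009] VII.2.1, VII.6.1, Ex. 3.5; memo HOME/w2c4/W2C4-MULT-TWOEXP-g10.md §8.
-/

set_option autoImplicit false
-- the Theorems namespace of a single-conjunct summit repeats the summit name by design (D-0017)
set_option linter.dupNamespace false

noncomputable section

open scoped NumberField TensorProduct ContRepresentation Classical
open CategoryTheory Field Function Finset IsDedekindDomain NumberField WeierstrassCurve
open Rat.HeightOneSpectrum
open Literature.NumberTheory.GaloisRepresentations Literature.NumberTheory.GaloisCohomology
open Literature.NumberTheory.GaloisRepresentations.DiscreteGaloisModule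
open Literature.NumberTheory.EllipticCurves Literature.NumberTheory.EllipticCurves.ModularForms
open Literature.NumberTheory.EllipticCurves.Rank1Residual
open Literature.NumberTheory.EllipticCurves.Kato2004
open Literature.NumberTheory.EllipticCurves.Kato2004.EulerSystemValues
open Summit.BirchSwinnertonDyer.Rank1Residual.GaloisImage
open Summit.BirchSwinnertonDyer.Rank1Residual.Additive.LocalLog
open Summit.BirchSwinnertonDyer.BirchSwinnertonDyer.Theorems
open Summit.BirchSwinnertonDyer.BirchSwinnertonDyer.Theorems.KimAtThreeKolyvaginDefs
open Summit.BirchSwinnertonDyer.BirchSwinnertonDyer.Theorems.KimAtThreeDeepUpperLocalLatticeUniform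
open Summit.BirchSwinnertonDyer.BirchSwinnertonDyer.Theorems.KimAtThreeDeepUpperRiderOfCompat
open Summit.BirchSwinnertonDyer.BirchSwinnertonDyer.Theorems.KimAtThreeShallowEqDeepMultOfDefinedKato
open Summit.BirchSwinnertonDyer.BirchSwinnertonDyer.Theorems.KimAtThreeShallowEqDeepGoodOfDefinedKato

namespace Summit.BirchSwinnertonDyer.BirchSwinnertonDyer.Theorems.KimAtThreeShallowEqDeepDefectOfDefinedKato

/-- Local notation: the TWO-EXPONENT rider clause (ii₂) at depth `j`, torsion slot `t`, defect exponent `e`,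
place `v`, for the pair `(Λ, Λf)` (seat acc6's RIDER₂, VERBATIM). -/
local notation3 (prettyPrint := false) "RIDER₂⟦" W' ", " j ", " t' ", " e' ", " v' ", " Λ' ", " Λf "⟧" =>
  ∀ (r : Finset (HeightOneSpectrum (𝓞 ℚ)))
    (Ψ : H1 (tateRep W' 3) (cycSubgroup 3 0 r) →+
      continuousCohomology 1
        (subgroupRep (WeierstrassCurve.torsionGaloisModule W' (((3 : ℕ) : ℤ) ^ j * ((3 : ℕ) : ℤ))).toTopRep
          (cycSubgroup 3 0 r))),
    (∀ (φ : contOneCocycles (subgroupRep (tateRep W' 3).toTopRep (cycSubgroup 3 0 r)))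
        (ψ : contOneCocycles
          (subgroupRep (WeierstrassCurve.torsionGaloisModule W' (((3 : ℕ) : ℤ) ^ j * ((3 : ℕ) : ℤ))).toTopRep
            (cycSubgroup 3 0 r))),
        (∀ g, ((ψ.1 g : geomTorsion W' (((3 : ℕ) : ℤ) ^ j * ((3 : ℕ) : ℤ))) : geomPoints W') =
          TateModule.proj 3 (j + 1) (φ.1 g)) →
        Ψ (oneCocycleClass _ φ) = oneCocycleClass _ ψ) →
    ∀ (y : H1 (tateRep W' 3) (cycSubgroup 3 0 r))
      (κ₀ : galoisCohomology (WeierstrassCurve.torsionGaloisModule W' (((3 : ℕ) : ℤ) ^ j * ((3 : ℕ) : ℤ))) 1)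
      (s : ℤ_[3]),
      resSubgroup (WeierstrassCurve.torsionGaloisModule W' (((3 : ℕ) : ℤ) ^ j * ((3 : ℕ) : ℤ))).toTopRep
          (cycSubgroup 3 0 r) 1 κ₀ = Ψ y →
      galoisCohomology.localization (WeierstrassCurve.torsionGaloisModule W' (((3 : ℕ) : ℤ) ^ j * ((3 : ℕ) : ℤ)))
          (Sum.inr v') 1 κ₀ ∈ propagatedSelmerStructure W' 3 j (Sum.inr v') →
      (∃ l ∈ cycIntLattice 3 (cycLevel 3 0 r),
          (((3 : ℕ) : ℤ_[3]) ^ t') • Λ' 0 r y - ((s : ℚ_[3]) ⊗ₜ[ℚ] (1 : CyclotomicField (cycLevel 3 0 r) ℚ)) =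
            (((3 : ℕ) : ℤ_[3]) ^ (j + 1)) • (l : ℚ_[3] ⊗[ℚ] CyclotomicField (cycLevel 3 0 r) ℚ)) →
      ((3 ^ e' : ℕ) : ZMod (3 ^ (j + 1))) *
        Λf (galoisCohomology.localization
          (WeierstrassCurve.torsionGaloisModule W' (((3 : ℕ) : ℤ) ^ j * ((3 : ℕ) : ℤ))) (Sum.inr v') 1 κ₀) =
        PadicInt.toZModPow (j + 1) s

/-- Local notation: the (Λ)-clauses of DICT3 for the finite-level functional `Λf j` at `v` (onto `ℤ/3^{j+1}` on
`𝓕_can(v)`, kernel the Kummer part). -/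
local notation3 (prettyPrint := false) "LAMBDA⟦" W' ", " v' ", " Λf "⟧" =>
  ∀ j : ℕ,
    (∀ c : ZMod (3 ^ (j + 1)), ∃ x ∈ propagatedSelmerStructure W' 3 j (Sum.inr v'), Λf j x = c) ∧
    (∀ x ∈ propagatedSelmerStructure W' 3 j (Sum.inr v'),
      Λf j x = 0 ↔ x ∈ WeierstrassCurve.kummerSelmerStructure W' (((3 : ℕ) : ℤ) ^ j * ((3 : ℕ) : ℤ)) (Sum.inr v'))

/-- Local notation: Kato's `ZetaBody` FAMILY for `(ι, κK, Λ)` and the cusp form `f'` at level `N'`. -/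
local notation3 (prettyPrint := false) "ZBODY⟦" W' ", " N' ", " f' ", " ι' ", " κ' ", " Λ' "⟧" =>
  ∀ (c d a : ℤ) (A : ℕ), 0 < A → Int.gcd c (6 * 3 * A) = 1 → Int.gcd d (6 * 3 * N') = 1 →
    ∃ (z : ∀ (k' : ℕ) (r : (cyclotomicLevelsRat 3 (badPlaces c d A N')).Ideals),
          H1 (tateRep W' 3) ((cyclotomicLevelsRat 3 (badPlaces c d A N')).level k' r.1))
      (x : ∀ (k' : ℕ) (r : (cyclotomicLevelsRat 3 (badPlaces c d A N')).Ideals),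
          CyclotomicField (cycLevel 3 k' r.1) ℚ),
      ZetaBody W' 3 f' ι' κ' Λ' c d a A z x

/-- Local notation: seat w2-c3's crude compatibility at depth `j` with EXACT exponent `b = 0`:
«`φ(h) ⊗ 1 − Λ_{0,r}(y) ∈ 3^{j+1}·L_int`». -/
local notation3 (prettyPrint := false) "COMPAT₀⟦" W' ", " j ", " v' ", " Λ' ", " φ0 "⟧" =>
  ∀ (r : Finset (HeightOneSpectrum (𝓞 ℚ)))
    (Ψ : H1 (tateRep W' 3) (cycSubgroup 3 0 r) →+
      continuousCohomology 1 (subgroupRep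
        (WeierstrassCurve.torsionGaloisModule W' (((3 : ℕ) : ℤ) ^ j * ((3 : ℕ) : ℤ))).toTopRep (cycSubgroup 3 0 r))),
    (∀ (φ₁ : contOneCocycles (subgroupRep (tateRep W' 3).toTopRep (cycSubgroup 3 0 r)))
        (ψ : contOneCocycles (subgroupRep
          (WeierstrassCurve.torsionGaloisModule W' (((3 : ℕ) : ℤ) ^ j * ((3 : ℕ) : ℤ))).toTopRep (cycSubgroup 3 0 r))),
        (∀ g, ((ψ.1 g : geomTorsion W' (((3 : ℕ) : ℤ) ^ j * ((3 : ℕ) : ℤ))) : geomPoints W') =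
          TateModule.proj 3 (j + 1) (φ₁.1 g)) →
        Ψ (oneCocycleClass _ φ₁) = oneCocycleClass _ ψ) →
    ∀ (y : H1 (tateRep W' 3) (cycSubgroup 3 0 r))
      (κ₀ : galoisCohomology (WeierstrassCurve.torsionGaloisModule W' (((3 : ℕ) : ℤ) ^ j * ((3 : ℕ) : ℤ))) 1)
      (h : (tateLocalRep W' 3 (Sum.inr v')).cohomology 1),
      resSubgroup (WeierstrassCurve.torsionGaloisModule W' (((3 : ℕ) : ℤ) ^ j * ((3 : ℕ) : ℤ))).toTopRep
          (cycSubgroup 3 0 r) 1 κ₀ = Ψ y →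
      galoisCohomology.localization (WeierstrassCurve.torsionGaloisModule W' (((3 : ℕ) : ℤ) ^ j * ((3 : ℕ) : ℤ)))
          (Sum.inr v') 1 κ₀ = tateLocalMap W' 3 j (Sum.inr v') h →
      ∃ l ∈ cycIntLattice 3 (cycLevel 3 0 r),
        (((3 : ℕ) : ℤ_[3]) ^ (0 : ℕ)) • ((φ0 h ⊗ₜ[ℚ] (1 : CyclotomicField (cycLevel 3 0 r) ℚ)) - Λ' 0 r y) =
          (((3 : ℕ) : ℤ_[3]) ^ (j + 1)) • (l : ℚ_[3] ⊗[ℚ] CyclotomicField (cycLevel 3 0 r) ℚ)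

/-- Local notation: **(C1ₑₓ⁰ᵘ) at the row `(W, v, P)`** — the DEFINED-KATO package with the EXACT compatibility `b = 0`
and R-κ. -/
local notation3 (prettyPrint := false) "DEFKATO₀ᵘ⟦" W' ", " v' ", " N' ", " P' "⟧" =>
  ∃ (ι : (n : ℕ) → (CyclotomicField n ℚ →+* ℂ)) (κK : ℝ)
    (Λ : ∀ (k' : ℕ) (r : Finset (HeightOneSpectrum (𝓞 ℚ))),
      H1 (tateRep W' 3) (cycSubgroup 3 k' r) →ₗ[ℤ_[3]] ℚ_[3] ⊗[ℚ] CyclotomicField (cycLevel 3 k' r) ℚ)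
    (φ : (tateLocalRep W' 3 (Sum.inr v')).cohomology 1 →+ ℚ_[3]),
    κK ≠ 0 ∧ (∃ u : ℚ, (u : ℝ) = κK ∧ padicValRat 3 u = 0) ∧
    (∀ y, φ y = 0 ↔ ∀ j : ℕ, tateLocalMap W' 3 j (Sum.inr v') y ∈
      WeierstrassCurve.kummerSelmerStructure W' (((3 : ℕ) : ℤ) ^ j * ((3 : ℕ) : ℤ)) (Sum.inr v')) ∧
    (∀ a : ℚ_[3], (∃ y, φ y = a) ↔
      ∀ Q : ((W' : WeierstrassCurve ℚ).baseChange ℚ_[3]).toAffine.Point,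
        ‖a * padicLog ((W' : WeierstrassCurve ℚ).baseChange ℚ_[3]) Q‖ ≤ 1) ∧
    (∀ j : ℕ, COMPAT₀⟦W', j, v', Λ, φ⟧) ∧
    ZBODY⟦W', N', (P' : ModularParametrizationData W' N').f, ι, κK, Λ⟧

/-- Local notation: **(C1₂) at the row `(W, v, P)`** — seat acc3's two-exponent fine Kato package (FINEKATO₂'s row
text). -/
local notation3 (prettyPrint := false) "FINEKATO₂⟦" W' ", " v' ", " N' ", " P' "⟧" =>
  ∃ (ι : (n : ℕ) → (CyclotomicField n ℚ →+* ℂ)) (κK : ℝ)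
    (Λ : ∀ (k' : ℕ) (r : Finset (HeightOneSpectrum (𝓞 ℚ))),
      H1 (tateRep W' 3) (cycSubgroup 3 k' r) →ₗ[ℤ_[3]]
        ℚ_[3] ⊗[ℚ] CyclotomicField (cycLevel 3 k' r) ℚ)
    (Λfin : ∀ j : ℕ, galoisCohomology
      ((WeierstrassCurve.torsionGaloisModule W' (((3 : ℕ) : ℤ) ^ j * ((3 : ℕ) : ℤ))).toLocal (Sum.inr v')) 1 →+
        ZMod (3 ^ (j + 1))) (e : ℕ),
    κK ≠ 0 ∧ (∃ u : ℚ, (u : ℝ) = κK ∧ padicValRat 3 u = 0) ∧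
    (LAMBDA⟦W', v', Λfin⟧) ∧
    (∀ j : ℕ, RIDER₂⟦W', j, 0, e, v', Λ, Λfin j⟧) ∧
    ZBODY⟦W', N', (P' : ModularParametrizationData W' N').f, ι, κK, Λ⟧

/-! ### §1 Normalisation at an additive `t = 0` row: `exp*_ω(H¹(ℚ₃,T)) = 3^{v₃(c₃)}·ℤ₃` from `hdual` -/

section Normalise

variable (W : WeierstrassCurve ℚ) [W.IsElliptic] [W.IsGloballyMinimal]
  (v : Place ℚ) (φ : (tateLocalRep W 3 v).cohomology 1 →+ ℚ_[3])

set_option backward.isDefEq.respectTransparency false in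
/-- **Kim's Lemma L′ at `p = 3`, `t = 0`, AS A THEOREM from `hdual`**: at an ADDITIVE `3` with `#E(ℚ₃)[3] = 1`,
`log_ω(E(ℚ₃)) = 3^{−v₃(c₃)}ℤ₃` (n1011's `range_padicLog_eq_span_zpow_of_isMinimal`; `#Ẽ_ns(𝔽₃) = 3`
(`reductionPointCount_of_additive`); `3 ∤ #tors`), so `φ = exp*_ω = 3^{v₃(c₃)}·φ′` with `φ′` integral and onto `ℤ₃`.
[cite: Kim2022StructureSelmer, §3.2.3 (display before Thm. 3.7), Thm. 3.6, Lemma 3.9] [cite: BlochKato1990, §3 (Prop. 3.8)]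
[cite: SilvermanAEC2009, VII.2.1, VII.6.1 and Exercise 3.5] -/
theorem exists_normalised_of_dual_of_additive
    (hdual : ∀ a : ℚ_[3], (∃ y, φ y = a) ↔
      ∀ P : (W.baseChange ℚ_[3]).toAffine.Point, ‖a * padicLog (W.baseChange ℚ_[3]) P‖ ≤ 1)
    (ht : Nat.card {Q : (W.baseChange ℚ_[3]).toAffine.Point // (3 : ℕ) • Q = 0} = 1)
    (hng : ¬ W.HasGoodReductionAtPrime 3) (hnm : ¬ W.HasMultiplicativeReductionAtPrime 3) :
    ∃ (φ' : (tateLocalRep W 3 v).cohomology 1 →+ ℚ_[3]),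
      (∀ y, ‖φ' y‖ ≤ 1) ∧ (∀ s : ℤ_[3], ∃ y, φ' y = s) ∧
      (∀ y, φ y = (3 : ℚ_[3]) ^ ((padicValNat 3 ((W.baseChange ℚ_[3]).localTamagawaNumber ℤ_[3]) : ℕ) : ℤ) *
        φ' y) := by
  haveI : (W.baseChange ℚ_[3]).IsMinimal ℤ_[3] := isMinimal_map_padic_of_isGloballyMinimal W 3
  set vc : ℕ := padicValNat 3 ((W.baseChange ℚ_[3]).localTamagawaNumber ℤ_[3]) with hvc
  set e : ℤ := (1 : ℤ) + padicValNat 3 (Nat.card (AddCommGroup.torsion (W.baseChange ℚ_[3]).toAffine.Point)) -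
      padicValNat 3 ((W.baseChange ℚ_[3]).localTamagawaNumber ℤ_[3]) -
      padicValNat 3 (Nat.card ((W.baseChange ℚ_[3]).reduction ℤ_[3]).toAffine.Point) with he
  have hrange := range_padicLog_eq_span_zpow_of_isMinimal (W.baseChange ℚ_[3])
  have htors : padicValNat 3 (Nat.card (AddCommGroup.torsion (W.baseChange ℚ_[3]).toAffine.Point)) = 0 :=
    padicValNat_card_torsion_eq_zero_of_card_torsionBy_eq_one 3 ht
  have hcard : Nat.card ((W.baseChange ℚ_[3]).reduction ℤ_[3]).toAffine.Point = 3 := by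
    rw [natCard_reduction_eq_reductionPointCount W, reductionPointCount_of_additive W 3 hng hnm]
  have he' : e = -(vc : ℤ) := by
    rw [he, htors, hcard, hvc, padicValNat.self (by norm_num)]; push_cast; ring
  have hiff : ∀ a : ℚ_[3], (∃ y, φ y = a) ↔ ‖a * (3 : ℚ_[3]) ^ e‖ ≤ 1 := by
    intro a
    rw [hdual a]
    constructor
    · intro h
      have hmem : ((3 : ℕ) : ℚ_[3]) ^ e ∈ (padicLog (W.baseChange ℚ_[3])).range := by
        rw [hrange, Submodule.mem_toAddSubgroup]
        exact Submodule.mem_span_singleton_self _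
      obtain ⟨P, hP⟩ := hmem
      have h' := h P
      rwa [hP, Nat.cast_ofNat] at h'
    · intro ha P
      have hP : padicLog (W.baseChange ℚ_[3]) P ∈ (padicLog (W.baseChange ℚ_[3])).range := ⟨P, rfl⟩
      rw [hrange, Submodule.mem_toAddSubgroup, Submodule.mem_span_singleton] at hP
      obtain ⟨c, hc'⟩ := hP
      rw [← hc', Algebra.smul_def, PadicInt.algebraMap_apply, ← mul_assoc, mul_comm a, mul_assoc, norm_mul,
        Nat.cast_ofNat]
      exact mul_le_one₀ (PadicInt.norm_le_one c) (norm_nonneg _) ha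
  have h30 : (3 : ℚ_[3]) ≠ 0 := by norm_num
  have hpe : (3 : ℚ_[3]) ^ e ≠ 0 := zpow_ne_zero e h30
  refine ⟨(AddMonoidHom.mulLeft ((3 : ℚ_[3]) ^ e)).comp φ, fun y => ?_, fun s => ?_, fun y => ?_⟩
  · rw [AddMonoidHom.comp_apply, AddMonoidHom.coe_mulLeft, mul_comm]
    exact (hiff (φ y)).mp ⟨y, rfl⟩
  · obtain ⟨y, hy⟩ := (hiff ((s : ℚ_[3]) * ((3 : ℚ_[3]) ^ e)⁻¹)).mpr (by
      rw [inv_mul_cancel_right₀ hpe]; exact PadicInt.norm_le_one s)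
    refine ⟨y, ?_⟩
    rw [AddMonoidHom.comp_apply, AddMonoidHom.coe_mulLeft, hy, mul_comm, inv_mul_cancel_right₀ hpe]
  · rw [AddMonoidHom.comp_apply, AddMonoidHom.coe_mulLeft, ← mul_assoc, he', zpow_neg, zpow_natCast,
      ← zpow_natCast, mul_inv_cancel₀ (zpow_ne_zero _ h30), one_mul]

end Normalise

/-! ### §2 (C1₂) from the defined-Kato package with the exact compatibility -/

section Row

variable (W : WeierstrassCurve ℚ) [W.IsElliptic] [W.IsGloballyMinimal]

omit [W.IsGloballyMinimal] in
/-- RIDER₂ at `(0, e)` for `3^0 • Λ` is RIDER₂ at `(0, e)` for `Λ` (bookkeeping). [folklore] -/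
theorem rider₂_of_smul_zero [ContinuousSMul ℤ_[3] (W.tateModule 3)] {j e : ℕ} {v : HeightOneSpectrum (𝓞 ℚ)}
    {Λ : ∀ (k' : ℕ) (r : Finset (HeightOneSpectrum (𝓞 ℚ))),
      H1 (tateRep W 3) (cycSubgroup 3 k' r) →ₗ[ℤ_[3]] ℚ_[3] ⊗[ℚ] CyclotomicField (cycLevel 3 k' r) ℚ}
    {Λf : galoisCohomology ((W.torsionGaloisModule (((3 : ℕ) : ℤ) ^ j * ((3 : ℕ) : ℤ))).toLocal
      (Sum.inr v)) 1 →+ ZMod (3 ^ (j + 1))}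
    (h : RIDER₂⟦W, j, 0, e, v, (fun k' r => (((3 : ℕ) : ℤ_[3]) ^ (0 : ℕ)) • Λ k' r), Λf⟧) :
    RIDER₂⟦W, j, 0, e, v, Λ, Λf⟧ := by
  intro r Ψ hΨ y κ₀ s hres hloc hval
  refine h r Ψ hΨ y κ₀ s hres hloc ?_
  obtain ⟨l, hl, heq⟩ := hval
  refine ⟨l, hl, ?_⟩
  rw [← heq, LinearMap.smul_apply, pow_zero, one_smul]

set_option backward.isDefEq.respectTransparency false in
/-- **(C1ₑₓ⁰ᵘ) ⟹ (C1₂) at an additive `t = 0` row.**  For a globally minimal `W` with ADDITIVE reduction at `3`, a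
place `v₃ ∣ 3`, `#E(ℚ₃)[3] = 1` and a parametrisation datum `P`: the defined-Kato package with the EXACT compatibility
(`b = 0`) and R-κ yields seat acc3's two-exponent fine package (C1₂) with `e := v₃(c₃)` — `Λfin` from the
normalised `φ′ = 3^{−v₃(c₃)}φ` (§1, `exists_finLevelFunctional_clauses_of_normalised`, `hker` transported), riders
by seat w2-c3's `rider₂_of_compat` at `(a, b, t) = (0, 0, 0)`.  On the Kato stratum (`3 ∤ c₃`) `e = 0`.  Nothing
constructed; nothing booked. [cite: Kim2022StructureSelmer, §3.2.3, Thm. 3.6, Lemma 3.9, Thm. 3.13]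
[cite: BlochKato1990, §3 (Prop. 3.8, Ex. 3.11)] [cite: Kato2004Asterisque, §9.4 (p. 188) and Thm. 9.7 (p. 189)] -/
theorem fineKato₂_of_definedKatoExact
    [ContinuousSMul ℤ_[3] (W.tateModule 3)] [Module.Free ℤ_[3] (W.tateModule 3)] [Module.Finite ℤ_[3] (W.tateModule 3)]
    {N : ℕ} [NeZero N] (P : ModularParametrizationData W N)
    (hng : ¬ W.HasGoodReductionAtPrime 3) (hnm : ¬ W.HasMultiplicativeReductionAtPrime 3)
    {v₃ : HeightOneSpectrum (𝓞 ℚ)}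
    (ht : Nat.card {Q : (W.baseChange ℚ_[3]).toAffine.Point // (3 : ℕ) • Q = 0} = 1)
    (hKU : DEFKATO₀ᵘ⟦W, v₃, N, P⟧) :
    FINEKATO₂⟦W, v₃, N, P⟧ := by
  obtain ⟨ι, κK, Λ, φ, hκ0, hunit, hker, hdual, hcompat, hz⟩ := hKU
  obtain ⟨φ', hint', hsurj', hφ⟩ := exists_normalised_of_dual_of_additive W (Sum.inr v₃) φ hdual ht hng hnm
  set e : ℕ := padicValNat 3 ((W.baseChange ℚ_[3]).localTamagawaNumber ℤ_[3]) with hedef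
  have hc : (3 : ℚ_[3]) ^ ((e : ℕ) : ℤ) ≠ 0 := zpow_ne_zero _ (by norm_num)
  have hker' := hker_of_eq_mul W 3 (Sum.inr v₃) φ hc hφ hker
  obtain ⟨Λfin, hΛ, hI⟩ := exists_finLevelFunctional_clauses_of_normalised W 3 (Sum.inr v₃) φ' hint' hsurj' hker'
  have he : (e : ℤ) = ((0 : ℕ) : ℤ) + ((0 : ℕ) : ℤ) + ((e : ℕ) : ℤ) := by push_cast; ring
  have hfin₂ : ∀ j : ℕ, RIDER₂⟦W, j, 0, e, v₃, Λ, Λfin j⟧ := fun j =>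
    rider₂_of_smul_zero W
      (rider₂_of_compat W v₃ Λ φ φ' ((e : ℕ) : ℤ) hφ hint' j (Λfin j) (hI j) 0 (hcompat j) 0 0 e le_rfl he)
  exact ⟨ι, κK, Λ, Λfin, e, hκ0, hunit, hΛ, hfin₂, hz⟩

end Row

end Summit.BirchSwinnertonDyer.BirchSwinnertonDyer.Theorems.KimAtThreeShallowEqDeepDefectOfDefinedKato

end
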